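import Literature.NumberTheory.Rogawski1990.TransferSideTransversalSums          -- (this seat) T-SUMS: `finsum_delta_mul_classOrbitalIntegral_eq_sum_of_transversal∕_of_family` (generic)
import Literature.NumberTheory.Rogawski1990.FinWeylDiscriminantFactorisation    -- ★ (N1) p852353: `weylDiscrThree_eq_finWeylRatio_mul_weylDiscrTwo` (`D_G = D_{G∕H} · D_H` on norm pairs)
import Literature.NumberTheory.Rogawski1990.FinExplicitTransferFactor           -- ★ `finExplicitDelta`, `finExplicitCollection`, `finTau`, `finWeylRatio`, `finKappaAt`
import Literature.NumberTheory.Rogawski1990.CMLocalAPacketMembers            -- ★ `Gqs`, `qsForm` (the quasi-split carrier abbreviations)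
import HarnessLib

/-!
# F0 · P3c · ROAD «UP-TR» (P2) «TRANSFER-RHS AS A FINSET SUM + (N1) FOLD»: the `G`-side of (4.3.1) for `Δ‴_v` as a finite sum over a transversal, the pointwise fold
# `D_G(γ) · (τ D_H κ α)(s, γ) = D_H(s)² · Δ‴(s, γ) · α(s)`, and the combination `= D_H(s)² α(s) Φ^st_H(s, f^H)` under the transfer relation
# (Rogawski 1990 §4.3 (4.3.1) p. 43, §4.9 p. 55 «`Δ‴ = τ · D_{G∕H} · κ`», §12.5 p. 183 ∕ Lemma 12.5.1)

Cell `pub/hodgecm-mathlib`, crux H413 = `stmt-HodgeConjecture-24833` (lane `--supports`, helper; count-neutral); seat F0P3a-p02 (g24); ROAD «UP-TR» holder F0P3-p02 (g23), DEAL #3h item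
**(P2)** (dealt 18:48:04Z to LH3-p04 (g8), who seat-closed 19:10:51Z without taking it; re-claimed 19:17:55Z).  THEOREMS ONLY; sorry-free; no definition ∕ instance ∕ notation ∕ named fact;
★-only imports; axioms TRIO.  Consumer: (A1′) «UP-TR ASSEMBLY» FILE E ∕ F (LH10-p01 (g8)), step (A-4) of ROAD v2 §A.

THE STEP (A-4).  After the exchange (A-3) the `G`-side integrand on the `H`-Cartan `T_H` at a `G`-regular `s` is the finite sum, over the EMB-FAMILY transversal `S` of the norm
partners of `s` (★ (N2b′) `exists_embFamily`), of `D_G(γ) · Φ_G([γ], f) · (τ(s) D_H(s) κ(s, γ) α(s))` (one `D_G` of the tube weight `D_G²` cancelled against the `D_G⁻¹` of (UP-DEF)).  With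
★ (N1) `D_G(γ) = D_{G∕H}(s) · D_H(s)` (`finWeylRatio`) and ★ `Δ‴(s, γ) = τ(s) · D_{G∕H}(s) · κ(s, γ)` (`finExplicitDelta_of_isLocalNormPair`) each term is
`D_H(s)² · α(s) · Δ‴(s, γ) Φ_G([γ], f)`; the transversal sum of `Δ‴(s, γ) Φ_G([γ], f)` IS the `finsum` of (4.3.1) (T-SUMS, generic), which IS `Φ^st_H(s, f^H)` by the transfer relation
★ `IsLocalDeltaTransfer` at the `G`-regular `s`.  `D_G`, `D_H` are the eDG ∕ eDH CLOSED FORMS of the RUNG0 block, inline (as ★ (N1)); §2 also carries the weight-ABSTRACT forms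
(`dg dh : ℝ` with the (N1) identity as a hypothesis) so a consumer with its own weight letters binds without unfolding.

* §1 (ii) FOLD: `mul_upSummand_eq_of_eq_mul` (abstract weights `dg = D_{G∕H}(s)·dh`) and **`weylDiscrThree_mul_upSummand_eq`** (eDG ∕ eDH closed forms; ★ (N1) inside).
* §2 (i) **`finsum_finExplicitDelta_mul_classOrbitalIntegral_eq_sum`**: `∑ᶠ c, (Δ‴-collection at v).Δ s c.out · Φ_G(c, f) = Σ_{γ ∈ S} Δ‴(s, γ) Φ_G(⟦γ⟧, f)` for a transversal `S` of the
  norm partners of `s` (exhaustive up to conjugacy, pairwise non-conjugate); **`…_eq_sum_attach_of_embFamily`**: the same over ★ (N2b′)'s family `γ ↦ e γ s` (its (iii)(iv) verbatim).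
* §3 (iii) COMBINATION: `sum_mul_upSummand_mul_classOrbitalIntegral_eq_of_eq_mul` (abstract weights) and **`sum_weylDiscrThree_mul_upSummand_mul_classOrbitalIntegral_eq`** (closed forms):
  `Σ_{γ ∈ S} D_G(γ) (τ D_H κ α)(s,γ) Φ_G(⟦γ⟧, f) = D_H(s)² · α(s) · Φ^st_H(s, f^H)` for `G`-regular `s`, `S ⊆` norm partners a transversal, under `IsLocalDeltaTransfer … f^H f`.
HONEST LABEL: count-neutral finite algebra; block consequents 11 → 10 → 9 only at the rider editions; organs 2 = 2; h413 registry untouched; HC_CM is proved only modulo the printed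
citations (2 remaining named inputs: hLiu418 = `stmt-HodgeConjecture-24832`, h413 = `stmt-HodgeConjecture-24833`) until rung 0 closes.

## References
* [Rogawski1990] J. D. Rogawski, *Automorphic Representations of Unitary Groups in Three Variables*, Ann. of Math. Stud. 123 (1990), §4.3 (4.3.1) p. 43; §4.9 p. 55; §12.5 pp. 182–183,
  Lemma 12.5.1.
-/

set_option autoImplicit false
-- the mandated namespace has the single-problem summit's repeated segment (`HodgeConjecture.HodgeConjecture`)
set_option linter.dupNamespace false

noncomputable section

open MeasureTheory NumberField IsDedekindDomain Matrix Polynomial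
open Literature.NumberTheory.GaloisRepresentations Literature.NumberTheory.GaloisRepresentations.IsNonarchimedeanLocalField
open Literature.NumberTheory.Automorphic Literature.NumberTheory.Automorphic.UnitaryGroup Literature.NumberTheory.Rogawski1990
open scoped NNReal MatrixGroups

namespace Summit.HodgeConjecture.HodgeConjecture.Cruxes.H413.F0P3cStCharTSUpTrTransferSide

variable (L : Type) [Field L] [NumberField L] [IsCMField L] (v : HeightOneSpectrum (𝓞 ↥(maximalRealSubfield L))) (μ : HeckeCharacter L)

/-! ## §1 (ii) The FOLD `D_G(γ) · (τ(s) D_H(s) κ(s, γ) α(s)) = D_H(s)² · (Δ‴(s, γ) α(s))` on a norm pair -/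

/-- **(P2)(ii), abstract weights** — if `dg = D_{G∕H,v}(s) · dh` (★ (N1) at the pair) then for any `a : ℂ`:
`dg · (τ(s) · dh · κ(s, γ) · a) = dh² · (Δ‴(s, γ) · a)` (★ `finExplicitDelta_of_isLocalNormPair`: `Δ‴ = τ · D_{G∕H} · κ` on the pair). [cite: Rogawski1990, §4.9 p. 55] -/
theorem mul_upSummand_eq_of_eq_mul
    {s : (UnitaryGroup.cmDatum L 2 (Matrix.of fun i j : Fin 2 => if i.val + j.val + 1 = 2 then (1 : L) else 0)).Local v ×
      (UnitaryGroup.cmDatum L 1 (Matrix.of fun i j : Fin 1 => if i.val + j.val + 1 = 1 then (1 : L) else 0)).Local v}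
    {γ : Gqs L v} (h : IsLocalNormPair L (qsForm L) v s γ) {dg dh : ℝ} (hdg : dg = finWeylRatio L v s * dh) (a : ℂ) :
    (dg : ℂ) * (finTau L v s μ * (dh : ℂ) * ((finKappaAt L v (qsForm L) s γ : ℤ) : ℂ) * a) =
      (dh : ℂ) ^ 2 * (finExplicitDelta L v (qsForm L) s μ γ * a) := by
  rw [finExplicitDelta_of_isLocalNormPair L v (qsForm L) s μ h, hdg]
  push_cast
  ring

/-- **(P2)(ii) FOLD, eDG ∕ eDH closed forms** — on a norm pair `ι_v(s) ↔ γ` at a non-split `v`: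
`D_G(γ) · (τ(s) D_H(s) κ(s, γ) a) = D_H(s)² · (Δ‴_v(s, γ) a)` with `D_G`, `D_H` the block's closed forms (★ (N1) `weylDiscrThree_eq_finWeylRatio_mul_weylDiscrTwo` + ★
`finExplicitDelta_of_isLocalNormPair`). [cite: Rogawski1990, §4.9 p. 55; §12.5 p. 183] -/
theorem weylDiscrThree_mul_upSummand_eq (hns : ∀ w : PlacesOver L v, IsCMField.complexConj L • w.1 = w.1)
    {s : (UnitaryGroup.cmDatum L 2 (Matrix.of fun i j : Fin 2 => if i.val + j.val + 1 = 2 then (1 : L) else 0)).Local v ×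
      (UnitaryGroup.cmDatum L 1 (Matrix.of fun i j : Fin 1 => if i.val + j.val + 1 = 1 then (1 : L) else 0)).Local v}
    {γ : Gqs L v} (h : IsLocalNormPair L (qsForm L) v s γ) (a : ℂ) :
    ((((NNReal.sqrt (NNReal.sqrt
        ((∏ w : PlacesOver L v, normAbs (w.1.adicCompletion L) (((γ.val : GL (Fin 3) (UnitaryGroup.LocalRing L v)).val.charpoly.discr) w)) *
          ((∏ w : PlacesOver L v, normAbs (w.1.adicCompletion L) (((γ.val : GL (Fin 3) (UnitaryGroup.LocalRing L v)).val.det) w)) ^ 2)⁻¹)) : ℝ≥0) : ℝ) : ℝ) : ℂ) *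
        (finTau L v s μ *
          ((((NNReal.sqrt (NNReal.sqrt
            ((∏ w : PlacesOver L v, normAbs (w.1.adicCompletion L) (((s.1.val : GL (Fin 2) (UnitaryGroup.LocalRing L v)).val.charpoly.discr) w)) *
              (∏ w : PlacesOver L v, normAbs (w.1.adicCompletion L) (((s.1.val : GL (Fin 2) (UnitaryGroup.LocalRing L v)).val.det) w))⁻¹)) : ℝ≥0) : ℝ) : ℝ) : ℂ) *
          ((finKappaAt L v (qsForm L) s γ : ℤ) : ℂ) * a) =
      ((((NNReal.sqrt (NNReal.sqrt
          ((∏ w : PlacesOver L v, normAbs (w.1.adicCompletion L) (((s.1.val : GL (Fin 2) (UnitaryGroup.LocalRing L v)).val.charpoly.discr) w)) *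
            (∏ w : PlacesOver L v, normAbs (w.1.adicCompletion L) (((s.1.val : GL (Fin 2) (UnitaryGroup.LocalRing L v)).val.det) w))⁻¹)) : ℝ≥0) : ℝ) : ℝ) : ℂ) ^ 2 *
        (finExplicitDelta L v (qsForm L) s μ γ * a) :=
  mul_upSummand_eq_of_eq_mul L v μ h (weylDiscrThree_eq_finWeylRatio_mul_weylDiscrTwo hns h) a

variable
  (hl : ∀ (v : HeightOneSpectrum (𝓞 ↥(maximalRealSubfield L)))
    (a : (UnitaryGroup.cmDatum L 2 (Matrix.of fun i j : Fin 2 => if i.val + j.val + 1 = 2 then (1 : L) else 0)).Local v ×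
      (UnitaryGroup.cmDatum L 1 (Matrix.of fun i j : Fin 1 => if i.val + j.val + 1 = 1 then (1 : L) else 0)).Local v)
    (b : (UnitaryGroup.cmDatum L 3 (qsForm L)).Local v)
    (x : (UnitaryGroup.cmDatum L 2 (Matrix.of fun i j : Fin 2 => if i.val + j.val + 1 = 2 then (1 : L) else 0)).Local v ×
      (UnitaryGroup.cmDatum L 1 (Matrix.of fun i j : Fin 1 => if i.val + j.val + 1 = 1 then (1 : L) else 0)).Local v),
    finExplicitDelta L v (qsForm L) (x * a * x⁻¹) μ b = finExplicitDelta L v (qsForm L) a μ b)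
  (hr : ∀ (v : HeightOneSpectrum (𝓞 ↥(maximalRealSubfield L)))
    (a : (UnitaryGroup.cmDatum L 2 (Matrix.of fun i j : Fin 2 => if i.val + j.val + 1 = 2 then (1 : L) else 0)).Local v ×
      (UnitaryGroup.cmDatum L 1 (Matrix.of fun i j : Fin 1 => if i.val + j.val + 1 = 1 then (1 : L) else 0)).Local v)
    (b y : (UnitaryGroup.cmDatum L 3 (qsForm L)).Local v),
    finExplicitDelta L v (qsForm L) a μ (y * b * y⁻¹) = finExplicitDelta L v (qsForm L) a μ b)
  [∀ γ : Gqs L v, MeasurableSpace (Gqs L v ⧸ Subgroup.centralizer ({γ} : Set (Gqs L v)))]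
  (mQv : OrbitalMeasureFamily (Gqs L v)) (f : Gqs L v → ℂ)

/-! ## §2 (i) The `G`-side of (4.3.1) for the `Δ‴` collection as a finite sum over a transversal of the norm partners -/

/-- **(P2)(i) — `∑ᶠ_c Δ‴_v(s, out c) Φ_G(c, f) = Σ_{γ ∈ S} Δ‴_v(s, γ) Φ_G(⟦γ⟧, f)`** for the explicit finite collection `(Δ‴_v)_v` (★ `finExplicitCollection`, support = norm pairs) and
a finite TRANSVERSAL `S` of the norm partners of `s` in `U(Φ₃)(L⁺_v)` (every `γ` with `ι_v(s) ↔ γ` conjugate to a member; members pairwise non-conjugate) — T-SUMS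
`finsum_delta_mul_classOrbitalIntegral_eq_sum_of_transversal` at `T := (Δ‴-collection) v`. [cite: Rogawski1990, §4.3 (4.3.1) p. 43; §4.9 p. 55] -/
theorem finsum_finExplicitDelta_mul_classOrbitalIntegral_eq_sum
    (s : (UnitaryGroup.cmDatum L 2 (Matrix.of fun i j : Fin 2 => if i.val + j.val + 1 = 2 then (1 : L) else 0)).Local v ×
      (UnitaryGroup.cmDatum L 1 (Matrix.of fun i j : Fin 1 => if i.val + j.val + 1 = 1 then (1 : L) else 0)).Local v)
    (S : Finset (Gqs L v)) (hexh : ∀ γ : Gqs L v, IsLocalNormPair L (qsForm L) v s γ → ∃ γc ∈ S, IsConj γc γ)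
    (hinj : ∀ γ ∈ S, ∀ γ' ∈ S, γ ≠ γ' → ¬ IsConj γ γ') :
    ∑ᶠ c : ConjClasses (Gqs L v), (finExplicitCollection L (qsForm L) μ hl hr v).Δ s (Quotient.out c) * classOrbitalIntegral mQv f c =
      ∑ γ ∈ S, finExplicitDelta L v (qsForm L) s μ γ * classOrbitalIntegral mQv f (ConjClasses.mk γ) := by
  rw [finsum_delta_mul_classOrbitalIntegral_eq_sum_of_transversal (finExplicitCollection L (qsForm L) μ hl hr v) mQv f s S hexh hinj]
  rfl

/-- **(P2)(i), EMB-FAMILY form** — over ★ (N2b′) `exists_embFamily`'s data at a point `s` of the `H`-Cartan `Z_H(γ₀)`: the family `γ ↦ e γ s` (`γ ∈ S`) with its EXHAUSTION (iii) and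
INJECTIVITY (iv) clauses verbatim: `∑ᶠ_c Δ‴_v(s, out c) Φ_G(c, f) = Σ_{γ ∈ S.attach} Δ‴_v(s, e γ s) Φ_G(⟦e γ s⟧, f)` — T-SUMS `…_eq_sum_of_family` at `ι := ↥S`.
[cite: Rogawski1990, §4.3 (4.3.1) p. 43; §12.5 p. 183] -/
theorem finsum_finExplicitDelta_mul_classOrbitalIntegral_eq_sum_attach_of_embFamily
    {γ₀ : (UnitaryGroup.cmDatum L 2 (Matrix.of fun i j : Fin 2 => if i.val + j.val + 1 = 2 then (1 : L) else 0)).Local v ×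
      (UnitaryGroup.cmDatum L 1 (Matrix.of fun i j : Fin 1 => if i.val + j.val + 1 = 1 then (1 : L) else 0)).Local v}
    (S : Finset (Gqs L v))
    (e : ∀ γ ∈ S, ↥(Subgroup.centralizer ({γ₀} : Set ((UnitaryGroup.cmDatum L 2 (Matrix.of fun i j : Fin 2 => if i.val + j.val + 1 = 2 then (1 : L) else 0)).Local v ×
      (UnitaryGroup.cmDatum L 1 (Matrix.of fun i j : Fin 1 => if i.val + j.val + 1 = 1 then (1 : L) else 0)).Local v))) ≃ₜ* ↥(Subgroup.centralizer ({γ} : Set (Gqs L v))))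
    (s : ↥(Subgroup.centralizer ({γ₀} : Set ((UnitaryGroup.cmDatum L 2 (Matrix.of fun i j : Fin 2 => if i.val + j.val + 1 = 2 then (1 : L) else 0)).Local v ×
      (UnitaryGroup.cmDatum L 1 (Matrix.of fun i j : Fin 1 => if i.val + j.val + 1 = 1 then (1 : L) else 0)).Local v))))
    (hexh : ∀ γ' : Gqs L v, IsLocalNormPair L (qsForm L) v s.1 γ' → ∃ γc, ∃ hc : γc ∈ S, IsConj (e γc hc s).1 γ')
    (hinj : ∀ γc (hc : γc ∈ S) γc' (hc' : γc' ∈ S), γc ≠ γc' → ¬ IsConj (e γc hc s).1 (e γc' hc' s).1) :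
    ∑ᶠ c : ConjClasses (Gqs L v), (finExplicitCollection L (qsForm L) μ hl hr v).Δ s.1 (Quotient.out c) * classOrbitalIntegral mQv f c =
      ∑ γ ∈ S.attach, finExplicitDelta L v (qsForm L) s.1 μ (e γ.1 γ.2 s).1 * classOrbitalIntegral mQv f (ConjClasses.mk ((e γ.1 γ.2 s).1 : Gqs L v)) := by
  have hexh' : ∀ k : Gqs L v, IsLocalNormPair L (qsForm L) v s.1 k → ∃ i ∈ S.attach, IsConj ((e i.1 i.2 s).1 : Gqs L v) k := by
    intro k hk
    obtain ⟨γc, hc, hconj⟩ := hexh k hk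
    exact ⟨⟨γc, hc⟩, Finset.mem_attach _ _, hconj⟩
  have hinj' : ∀ i ∈ S.attach, ∀ j ∈ S.attach, i ≠ j → ¬ IsConj ((e i.1 i.2 s).1 : Gqs L v) ((e j.1 j.2 s).1 : Gqs L v) :=
    fun i _ j _ hij => hinj i.1 i.2 j.1 j.2 fun h => hij (Subtype.ext h)
  rw [finsum_delta_mul_classOrbitalIntegral_eq_sum_of_family (finExplicitCollection L (qsForm L) μ hl hr v) mQv f s.1 S.attach
    (fun i => ((e i.1 i.2 s).1 : Gqs L v)) hexh' hinj']
  rfl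

/-! ## §3 (iii) The COMBINATION: the `D_G`-weighted fibre sum is `D_H(s)² · α(s) · Φ^st_H(s, f^H)` under the transfer relation -/

/-- **(P2)(iii), abstract weights** — `s` `G`-regular, `S` a transversal of its norm partners consisting of norm partners, weights with `dg γ = D_{G∕H}(s) · dh` on `S`, and `f^H` a
`Δ‴`-transfer of `f` (★ `IsLocalDeltaTransfer` for the explicit collection): `Σ_{γ ∈ S} dg(γ) · (τ dh κ α)(s, γ) · Φ_G(⟦γ⟧, f) = dh² · α(s) · Φ^st_H(s, f^H)`.
[cite: Rogawski1990, §4.3 (4.3.1) p. 43; §4.9 p. 55; §12.5 p. 183] -/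
theorem sum_mul_upSummand_mul_classOrbitalIntegral_eq_of_eq_mul
    [∀ a : ((UnitaryGroup.cmDatum L 2 (Matrix.of fun i j : Fin 2 => if i.val + j.val + 1 = 2 then (1 : L) else 0)).Local v ×
        (UnitaryGroup.cmDatum L 1 (Matrix.of fun i j : Fin 1 => if i.val + j.val + 1 = 1 then (1 : L) else 0)).Local v),
      MeasurableSpace (((UnitaryGroup.cmDatum L 2 (Matrix.of fun i j : Fin 2 => if i.val + j.val + 1 = 2 then (1 : L) else 0)).Local v ×
        (UnitaryGroup.cmDatum L 1 (Matrix.of fun i j : Fin 1 => if i.val + j.val + 1 = 1 then (1 : L) else 0)).Local v) ⧸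
        Subgroup.centralizer ({a} : Set ((UnitaryGroup.cmDatum L 2 (Matrix.of fun i j : Fin 2 => if i.val + j.val + 1 = 2 then (1 : L) else 0)).Local v ×
        (UnitaryGroup.cmDatum L 1 (Matrix.of fun i j : Fin 1 => if i.val + j.val + 1 = 1 then (1 : L) else 0)).Local v)))]
    (mHv : OrbitalMeasureFamily ((UnitaryGroup.cmDatum L 2 (Matrix.of fun i j : Fin 2 => if i.val + j.val + 1 = 2 then (1 : L) else 0)).Local v ×
      (UnitaryGroup.cmDatum L 1 (Matrix.of fun i j : Fin 1 => if i.val + j.val + 1 = 1 then (1 : L) else 0)).Local v))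
    (fH : ((UnitaryGroup.cmDatum L 2 (Matrix.of fun i j : Fin 2 => if i.val + j.val + 1 = 2 then (1 : L) else 0)).Local v ×
      (UnitaryGroup.cmDatum L 1 (Matrix.of fun i j : Fin 1 => if i.val + j.val + 1 = 1 then (1 : L) else 0)).Local v) → ℂ)
    (hT : IsLocalDeltaTransfer L (qsForm L) v (finExplicitCollection L (qsForm L) μ hl hr v) mHv mQv fH f)
    {s : (UnitaryGroup.cmDatum L 2 (Matrix.of fun i j : Fin 2 => if i.val + j.val + 1 = 2 then (1 : L) else 0)).Local v ×
      (UnitaryGroup.cmDatum L 1 (Matrix.of fun i j : Fin 1 => if i.val + j.val + 1 = 1 then (1 : L) else 0)).Local v}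
    (hs : IsLocalGRegular L v s) (S : Finset (Gqs L v)) (hS : ∀ γ ∈ S, IsLocalNormPair L (qsForm L) v s γ)
    (hexh : ∀ γ : Gqs L v, IsLocalNormPair L (qsForm L) v s γ → ∃ γc ∈ S, IsConj γc γ) (hinj : ∀ γ ∈ S, ∀ γ' ∈ S, γ ≠ γ' → ¬ IsConj γ γ')
    (dg : Gqs L v → ℝ) (dh : ℝ) (hdg : ∀ γ ∈ S, dg γ = finWeylRatio L v s * dh)
    (α : ((UnitaryGroup.cmDatum L 2 (Matrix.of fun i j : Fin 2 => if i.val + j.val + 1 = 2 then (1 : L) else 0)).Local v ×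
      (UnitaryGroup.cmDatum L 1 (Matrix.of fun i j : Fin 1 => if i.val + j.val + 1 = 1 then (1 : L) else 0)).Local v) → ℂ) :
    ∑ γ ∈ S, (dg γ : ℂ) * (finTau L v s μ * (dh : ℂ) * ((finKappaAt L v (qsForm L) s γ : ℤ) : ℂ) * α s) * classOrbitalIntegral mQv f (ConjClasses.mk γ) =
      (dh : ℂ) ^ 2 * α s * stableOrbitalIntegralRel (IsLocalStablyConjH L v) mHv fH s := by
  have hst : stableOrbitalIntegralRel (IsLocalStablyConjH L v) mHv fH s =
      ∑ γ ∈ S, finExplicitDelta L v (qsForm L) s μ γ * classOrbitalIntegral mQv f (ConjClasses.mk γ) := by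
    rw [← finsum_finExplicitDelta_mul_classOrbitalIntegral_eq_sum L v μ hl hr mQv f s S hexh hinj]
    exact hT s hs
  rw [hst, Finset.mul_sum]
  refine Finset.sum_congr rfl fun γ hγ => ?_
  rw [mul_upSummand_eq_of_eq_mul L v μ (hS γ hγ) (hdg γ hγ) (α s)]
  ring

/-- **(P2)(iii) COMBINATION, eDG ∕ eDH closed forms** — `s` `G`-regular at a non-split `v`, `S` a transversal of its norm partners made of norm partners, `f^H` a `Δ‴`-transfer of `f`:
`Σ_{γ ∈ S} D_G(γ) · (τ(s) D_H(s) κ(s,γ) α(s)) · Φ_G(⟦γ⟧, f) = D_H(s)² · α(s) · Φ^st_H(s, f^H)` (`Φ^st_H` = ★ `stableOrbitalIntegralRel (IsLocalStablyConjH L v) mHv fH s`).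
[cite: Rogawski1990, §4.3 (4.3.1) p. 43; §4.9 p. 55; §12.5 p. 183, Lemma 12.5.1] -/
theorem sum_weylDiscrThree_mul_upSummand_mul_classOrbitalIntegral_eq (hns : ∀ w : PlacesOver L v, IsCMField.complexConj L • w.1 = w.1)
    [∀ a : ((UnitaryGroup.cmDatum L 2 (Matrix.of fun i j : Fin 2 => if i.val + j.val + 1 = 2 then (1 : L) else 0)).Local v ×
        (UnitaryGroup.cmDatum L 1 (Matrix.of fun i j : Fin 1 => if i.val + j.val + 1 = 1 then (1 : L) else 0)).Local v),
      MeasurableSpace (((UnitaryGroup.cmDatum L 2 (Matrix.of fun i j : Fin 2 => if i.val + j.val + 1 = 2 then (1 : L) else 0)).Local v ×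
        (UnitaryGroup.cmDatum L 1 (Matrix.of fun i j : Fin 1 => if i.val + j.val + 1 = 1 then (1 : L) else 0)).Local v) ⧸
        Subgroup.centralizer ({a} : Set ((UnitaryGroup.cmDatum L 2 (Matrix.of fun i j : Fin 2 => if i.val + j.val + 1 = 2 then (1 : L) else 0)).Local v ×
        (UnitaryGroup.cmDatum L 1 (Matrix.of fun i j : Fin 1 => if i.val + j.val + 1 = 1 then (1 : L) else 0)).Local v)))]
    (mHv : OrbitalMeasureFamily ((UnitaryGroup.cmDatum L 2 (Matrix.of fun i j : Fin 2 => if i.val + j.val + 1 = 2 then (1 : L) else 0)).Local v ×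
      (UnitaryGroup.cmDatum L 1 (Matrix.of fun i j : Fin 1 => if i.val + j.val + 1 = 1 then (1 : L) else 0)).Local v))
    (fH : ((UnitaryGroup.cmDatum L 2 (Matrix.of fun i j : Fin 2 => if i.val + j.val + 1 = 2 then (1 : L) else 0)).Local v ×
      (UnitaryGroup.cmDatum L 1 (Matrix.of fun i j : Fin 1 => if i.val + j.val + 1 = 1 then (1 : L) else 0)).Local v) → ℂ)
    (hT : IsLocalDeltaTransfer L (qsForm L) v (finExplicitCollection L (qsForm L) μ hl hr v) mHv mQv fH f)
    {s : (UnitaryGroup.cmDatum L 2 (Matrix.of fun i j : Fin 2 => if i.val + j.val + 1 = 2 then (1 : L) else 0)).Local v ×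
      (UnitaryGroup.cmDatum L 1 (Matrix.of fun i j : Fin 1 => if i.val + j.val + 1 = 1 then (1 : L) else 0)).Local v}
    (hs : IsLocalGRegular L v s) (S : Finset (Gqs L v)) (hS : ∀ γ ∈ S, IsLocalNormPair L (qsForm L) v s γ)
    (hexh : ∀ γ : Gqs L v, IsLocalNormPair L (qsForm L) v s γ → ∃ γc ∈ S, IsConj γc γ) (hinj : ∀ γ ∈ S, ∀ γ' ∈ S, γ ≠ γ' → ¬ IsConj γ γ')
    (α : ((UnitaryGroup.cmDatum L 2 (Matrix.of fun i j : Fin 2 => if i.val + j.val + 1 = 2 then (1 : L) else 0)).Local v ×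
      (UnitaryGroup.cmDatum L 1 (Matrix.of fun i j : Fin 1 => if i.val + j.val + 1 = 1 then (1 : L) else 0)).Local v) → ℂ) :
    ∑ γ ∈ S, ((((NNReal.sqrt (NNReal.sqrt
        ((∏ w : PlacesOver L v, normAbs (w.1.adicCompletion L) (((γ.val : GL (Fin 3) (UnitaryGroup.LocalRing L v)).val.charpoly.discr) w)) *
          ((∏ w : PlacesOver L v, normAbs (w.1.adicCompletion L) (((γ.val : GL (Fin 3) (UnitaryGroup.LocalRing L v)).val.det) w)) ^ 2)⁻¹)) : ℝ≥0) : ℝ) : ℝ) : ℂ) *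
        (finTau L v s μ *
          ((((NNReal.sqrt (NNReal.sqrt
            ((∏ w : PlacesOver L v, normAbs (w.1.adicCompletion L) (((s.1.val : GL (Fin 2) (UnitaryGroup.LocalRing L v)).val.charpoly.discr) w)) *
              (∏ w : PlacesOver L v, normAbs (w.1.adicCompletion L) (((s.1.val : GL (Fin 2) (UnitaryGroup.LocalRing L v)).val.det) w))⁻¹)) : ℝ≥0) : ℝ) : ℝ) : ℂ) *
          ((finKappaAt L v (qsForm L) s γ : ℤ) : ℂ) * α s) * classOrbitalIntegral mQv f (ConjClasses.mk γ) =
      ((((NNReal.sqrt (NNReal.sqrt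
          ((∏ w : PlacesOver L v, normAbs (w.1.adicCompletion L) (((s.1.val : GL (Fin 2) (UnitaryGroup.LocalRing L v)).val.charpoly.discr) w)) *
            (∏ w : PlacesOver L v, normAbs (w.1.adicCompletion L) (((s.1.val : GL (Fin 2) (UnitaryGroup.LocalRing L v)).val.det) w))⁻¹)) : ℝ≥0) : ℝ) : ℝ) : ℂ) ^ 2 *
        α s * stableOrbitalIntegralRel (IsLocalStablyConjH L v) mHv fH s :=
  sum_mul_upSummand_mul_classOrbitalIntegral_eq_of_eq_mul L v μ hl hr mQv f mHv fH hT hs S hS hexh hinj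
    (fun γ => (((NNReal.sqrt (NNReal.sqrt
        ((∏ w : PlacesOver L v, normAbs (w.1.adicCompletion L) (((γ.val : GL (Fin 3) (UnitaryGroup.LocalRing L v)).val.charpoly.discr) w)) *
          ((∏ w : PlacesOver L v, normAbs (w.1.adicCompletion L) (((γ.val : GL (Fin 3) (UnitaryGroup.LocalRing L v)).val.det) w)) ^ 2)⁻¹)) : ℝ≥0) : ℝ) : ℝ))
    _ (fun γ hγ => weylDiscrThree_eq_finWeylRatio_mul_weylDiscrTwo hns (hS γ hγ)) α

end Summit.HodgeConjecture.HodgeConjecture.Cruxes.H413.F0P3cStCharTSUpTrTransferSide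

/-! ## §4 (ED. 2) FAMILY-indexed forms of (i) and (iii) — the shape of the (A1′) FILE E binder `hP2` (`∑ i : Fin (n T)`, family `i ↦ e_T i s`) -/

namespace Summit.HodgeConjecture.HodgeConjecture.Cruxes.H413.F0P3cStCharTSUpTrTransferSide

variable (L : Type) [Field L] [NumberField L] [IsCMField L] (v : HeightOneSpectrum (𝓞 ↥(maximalRealSubfield L))) (μ : HeckeCharacter L)
  (hl : ∀ (v : HeightOneSpectrum (𝓞 ↥(maximalRealSubfield L)))
    (a : (UnitaryGroup.cmDatum L 2 (Matrix.of fun i j : Fin 2 => if i.val + j.val + 1 = 2 then (1 : L) else 0)).Local v ×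
      (UnitaryGroup.cmDatum L 1 (Matrix.of fun i j : Fin 1 => if i.val + j.val + 1 = 1 then (1 : L) else 0)).Local v)
    (b : (UnitaryGroup.cmDatum L 3 (qsForm L)).Local v)
    (x : (UnitaryGroup.cmDatum L 2 (Matrix.of fun i j : Fin 2 => if i.val + j.val + 1 = 2 then (1 : L) else 0)).Local v ×
      (UnitaryGroup.cmDatum L 1 (Matrix.of fun i j : Fin 1 => if i.val + j.val + 1 = 1 then (1 : L) else 0)).Local v),
    finExplicitDelta L v (qsForm L) (x * a * x⁻¹) μ b = finExplicitDelta L v (qsForm L) a μ b)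
  (hr : ∀ (v : HeightOneSpectrum (𝓞 ↥(maximalRealSubfield L)))
    (a : (UnitaryGroup.cmDatum L 2 (Matrix.of fun i j : Fin 2 => if i.val + j.val + 1 = 2 then (1 : L) else 0)).Local v ×
      (UnitaryGroup.cmDatum L 1 (Matrix.of fun i j : Fin 1 => if i.val + j.val + 1 = 1 then (1 : L) else 0)).Local v)
    (b y : (UnitaryGroup.cmDatum L 3 (qsForm L)).Local v),
    finExplicitDelta L v (qsForm L) a μ (y * b * y⁻¹) = finExplicitDelta L v (qsForm L) a μ b)
  [∀ γ : Gqs L v, MeasurableSpace (Gqs L v ⧸ Subgroup.centralizer ({γ} : Set (Gqs L v)))]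
  (mQv : OrbitalMeasureFamily (Gqs L v)) (f : Gqs L v → ℂ)
  [∀ a : ((UnitaryGroup.cmDatum L 2 (Matrix.of fun i j : Fin 2 => if i.val + j.val + 1 = 2 then (1 : L) else 0)).Local v ×
      (UnitaryGroup.cmDatum L 1 (Matrix.of fun i j : Fin 1 => if i.val + j.val + 1 = 1 then (1 : L) else 0)).Local v),
    MeasurableSpace (((UnitaryGroup.cmDatum L 2 (Matrix.of fun i j : Fin 2 => if i.val + j.val + 1 = 2 then (1 : L) else 0)).Local v ×
      (UnitaryGroup.cmDatum L 1 (Matrix.of fun i j : Fin 1 => if i.val + j.val + 1 = 1 then (1 : L) else 0)).Local v) ⧸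
      Subgroup.centralizer ({a} : Set ((UnitaryGroup.cmDatum L 2 (Matrix.of fun i j : Fin 2 => if i.val + j.val + 1 = 2 then (1 : L) else 0)).Local v ×
      (UnitaryGroup.cmDatum L 1 (Matrix.of fun i j : Fin 1 => if i.val + j.val + 1 = 1 then (1 : L) else 0)).Local v)))]
  (mHv : OrbitalMeasureFamily ((UnitaryGroup.cmDatum L 2 (Matrix.of fun i j : Fin 2 => if i.val + j.val + 1 = 2 then (1 : L) else 0)).Local v ×
    (UnitaryGroup.cmDatum L 1 (Matrix.of fun i j : Fin 1 => if i.val + j.val + 1 = 1 then (1 : L) else 0)).Local v))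
  (fH : ((UnitaryGroup.cmDatum L 2 (Matrix.of fun i j : Fin 2 => if i.val + j.val + 1 = 2 then (1 : L) else 0)).Local v ×
    (UnitaryGroup.cmDatum L 1 (Matrix.of fun i j : Fin 1 => if i.val + j.val + 1 = 1 then (1 : L) else 0)).Local v) → ℂ)
  (hT : IsLocalDeltaTransfer L (qsForm L) v (finExplicitCollection L (qsForm L) μ hl hr v) mHv mQv fH f)

include hT in
/-- **(P2)(iii), FAMILY form, abstract weights** — the (A1′) FILE E binder shape: for `G`-regular `s`, a finite FAMILY `b : ι → U(Φ₃)(L⁺_v)` over `S : Finset ι` of norm partners of `s`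
which exhausts the norm partners up to conjugacy and is injective up to conjugacy (★ (N2b′) (iii)(iv) ∕ ★ (X2)), weights `dg (b i) = D_{G∕H}(s) · dh` on the family, and a
`Δ‴`-transfer `f^H` of `f`: `Σ_{i ∈ S} dg(b i) · (τ(s) dh κ(s, b i) α(s)) · Φ_G(⟦b i⟧, f) = dh² · α(s) · Φ^st_H(s, f^H)`. [cite: Rogawski1990, §4.3 (4.3.1) p. 43; §4.9 p. 55; §12.5 p. 183] -/
theorem sum_family_mul_upSummand_mul_classOrbitalIntegral_eq_of_eq_mul {ι : Type*}
    {s : (UnitaryGroup.cmDatum L 2 (Matrix.of fun i j : Fin 2 => if i.val + j.val + 1 = 2 then (1 : L) else 0)).Local v ×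
      (UnitaryGroup.cmDatum L 1 (Matrix.of fun i j : Fin 1 => if i.val + j.val + 1 = 1 then (1 : L) else 0)).Local v}
    (hs : IsLocalGRegular L v s) (S : Finset ι) (b : ι → Gqs L v) (hS : ∀ i ∈ S, IsLocalNormPair L (qsForm L) v s (b i))
    (hexh : ∀ γ : Gqs L v, IsLocalNormPair L (qsForm L) v s γ → ∃ i ∈ S, IsConj (b i) γ) (hinj : ∀ i ∈ S, ∀ j ∈ S, i ≠ j → ¬ IsConj (b i) (b j))
    (dg : Gqs L v → ℝ) (dh : ℝ) (hdg : ∀ i ∈ S, dg (b i) = finWeylRatio L v s * dh)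
    (α : ((UnitaryGroup.cmDatum L 2 (Matrix.of fun i j : Fin 2 => if i.val + j.val + 1 = 2 then (1 : L) else 0)).Local v ×
      (UnitaryGroup.cmDatum L 1 (Matrix.of fun i j : Fin 1 => if i.val + j.val + 1 = 1 then (1 : L) else 0)).Local v) → ℂ) :
    ∑ i ∈ S, (dg (b i) : ℂ) * (finTau L v s μ * (dh : ℂ) * ((finKappaAt L v (qsForm L) s (b i) : ℤ) : ℂ) * α s) * classOrbitalIntegral mQv f (ConjClasses.mk (b i)) =
      (dh : ℂ) ^ 2 * α s * stableOrbitalIntegralRel (IsLocalStablyConjH L v) mHv fH s := by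
  have hst : stableOrbitalIntegralRel (IsLocalStablyConjH L v) mHv fH s =
      ∑ i ∈ S, finExplicitDelta L v (qsForm L) s μ (b i) * classOrbitalIntegral mQv f (ConjClasses.mk (b i)) := by
    rw [show stableOrbitalIntegralRel (IsLocalStablyConjH L v) mHv fH s =
        ∑ᶠ c : ConjClasses (Gqs L v), (finExplicitCollection L (qsForm L) μ hl hr v).Δ s (Quotient.out c) * classOrbitalIntegral mQv f c from hT s hs,
      finsum_delta_mul_classOrbitalIntegral_eq_sum_of_family (finExplicitCollection L (qsForm L) μ hl hr v) mQv f s S b hexh hinj]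
    rfl
  rw [hst, Finset.mul_sum]
  refine Finset.sum_congr rfl fun i hi => ?_
  rw [mul_upSummand_eq_of_eq_mul L v μ (hS i hi) (hdg i hi) (α s)]
  ring

include hT in
/-- **(P2)(iii), FAMILY form, eDG ∕ eDH closed forms** (`v` non-split): for `G`-regular `s`, a transversal family `b : ι → U(Φ₃)(L⁺_v)` over `S` of norm partners of `s` (exhaustive,
injective up to conjugacy) and a `Δ‴`-transfer `f^H` of `f`: `Σ_{i ∈ S} D_G(b i) · (τ(s) D_H(s) κ(s, b i) α(s)) · Φ_G(⟦b i⟧, f) = D_H(s)² · α(s) · Φ^st_H(s, f^H)` — at `ι := Fin (n T)`,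
`S := univ`, `b i := e_T i s` this is the (A1′) binder `hP2` verbatim up to the names of the closed forms. [cite: Rogawski1990, §4.3 (4.3.1) p. 43; §4.9 p. 55; §12.5 p. 183, Lemma 12.5.1] -/
theorem sum_family_weylDiscrThree_mul_upSummand_mul_classOrbitalIntegral_eq (hns : ∀ w : PlacesOver L v, IsCMField.complexConj L • w.1 = w.1) {ι : Type*}
    {s : (UnitaryGroup.cmDatum L 2 (Matrix.of fun i j : Fin 2 => if i.val + j.val + 1 = 2 then (1 : L) else 0)).Local v ×
      (UnitaryGroup.cmDatum L 1 (Matrix.of fun i j : Fin 1 => if i.val + j.val + 1 = 1 then (1 : L) else 0)).Local v}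
    (hs : IsLocalGRegular L v s) (S : Finset ι) (b : ι → Gqs L v) (hS : ∀ i ∈ S, IsLocalNormPair L (qsForm L) v s (b i))
    (hexh : ∀ γ : Gqs L v, IsLocalNormPair L (qsForm L) v s γ → ∃ i ∈ S, IsConj (b i) γ) (hinj : ∀ i ∈ S, ∀ j ∈ S, i ≠ j → ¬ IsConj (b i) (b j))
    (α : ((UnitaryGroup.cmDatum L 2 (Matrix.of fun i j : Fin 2 => if i.val + j.val + 1 = 2 then (1 : L) else 0)).Local v ×
      (UnitaryGroup.cmDatum L 1 (Matrix.of fun i j : Fin 1 => if i.val + j.val + 1 = 1 then (1 : L) else 0)).Local v) → ℂ) :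
    ∑ i ∈ S, ((((NNReal.sqrt (NNReal.sqrt
        ((∏ w : PlacesOver L v, normAbs (w.1.adicCompletion L) ((((b i).val : GL (Fin 3) (UnitaryGroup.LocalRing L v)).val.charpoly.discr) w)) *
          ((∏ w : PlacesOver L v, normAbs (w.1.adicCompletion L) ((((b i).val : GL (Fin 3) (UnitaryGroup.LocalRing L v)).val.det) w)) ^ 2)⁻¹)) : ℝ≥0) : ℝ) : ℝ) : ℂ) *
        (finTau L v s μ *
          ((((NNReal.sqrt (NNReal.sqrt
            ((∏ w : PlacesOver L v, normAbs (w.1.adicCompletion L) (((s.1.val : GL (Fin 2) (UnitaryGroup.LocalRing L v)).val.charpoly.discr) w)) *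
              (∏ w : PlacesOver L v, normAbs (w.1.adicCompletion L) (((s.1.val : GL (Fin 2) (UnitaryGroup.LocalRing L v)).val.det) w))⁻¹)) : ℝ≥0) : ℝ) : ℝ) : ℂ) *
          ((finKappaAt L v (qsForm L) s (b i) : ℤ) : ℂ) * α s) * classOrbitalIntegral mQv f (ConjClasses.mk (b i)) =
      ((((NNReal.sqrt (NNReal.sqrt
          ((∏ w : PlacesOver L v, normAbs (w.1.adicCompletion L) (((s.1.val : GL (Fin 2) (UnitaryGroup.LocalRing L v)).val.charpoly.discr) w)) *
            (∏ w : PlacesOver L v, normAbs (w.1.adicCompletion L) (((s.1.val : GL (Fin 2) (UnitaryGroup.LocalRing L v)).val.det) w))⁻¹)) : ℝ≥0) : ℝ) : ℝ) : ℂ) ^ 2 *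
        α s * stableOrbitalIntegralRel (IsLocalStablyConjH L v) mHv fH s :=
  sum_family_mul_upSummand_mul_classOrbitalIntegral_eq_of_eq_mul L v μ hl hr mQv f mHv fH hT hs S b hS hexh hinj
    (fun γ => (((NNReal.sqrt (NNReal.sqrt
        ((∏ w : PlacesOver L v, normAbs (w.1.adicCompletion L) (((γ.val : GL (Fin 3) (UnitaryGroup.LocalRing L v)).val.charpoly.discr) w)) *
          ((∏ w : PlacesOver L v, normAbs (w.1.adicCompletion L) (((γ.val : GL (Fin 3) (UnitaryGroup.LocalRing L v)).val.det) w)) ^ 2)⁻¹)) : ℝ≥0) : ℝ) : ℝ))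
    _ (fun i hi => weylDiscrThree_eq_finWeylRatio_mul_weylDiscrTwo hns (hS i hi)) α

end Summit.HodgeConjecture.HodgeConjecture.Cruxes.H413.F0P3cStCharTSUpTrTransferSide
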